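import Literature.RepresentationTheory.GeneralLinear.SL2TripleCommutant
import HarnessLib

/-!
# The double commutant of an `𝔰𝔩₂`-triple in isotypic position is `K P ⊕ K (1 − P) ⊕ K E ⊕ K F`

Family `hodge`, layer `Literature/RepresentationTheory/GeneralLinear`; THEOREMS ONLY (no definition, no named fact;
D-0026).  Pure linear algebra over a field `K`, NO Hodge theory imported; sequel of `SL2TripleCommutant` (cell
`pub-hodgecm2` (COR-CM) count-neutral lane MT-RANK-FOUR-DIVISORS, seat b27), where it is applied to the complexified Lie
algebra of the Hodge group of a weight-one Hodge structure of Hodge-group rank `3`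
(`Motives/HodgeThetaSubalgebraRankThree`).

SETTING (as in `SL2TripleCommutant`).  `W` a `K`-space and `P, E, F ∈ End W`, `α ∈ Kˣ` with
`P² = P`, `P E = E`, `E P = 0`, `P F = 0`, `F P = F`, `E F = α P`, `F E = α (1 − P)` — `W = W₁ ⊕ W₀` (`W₁ = range P`),
`E : W₀ ⥲ W₁`, `F : W₁ ⥲ W₀`: the standard representation of `𝔰𝔩₂ = ⟨2P − 1, E, F⟩` tensored with `W₁`; `C ⊆ End W` the
COMMUTANT of `{P, E, F}` (hypothesis `hC`).

* `corner_eq_smul_of_forall_commute_corner` — a corner element `A = P A P` commuting with every corner element `P u P`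
  is `c P` (test against rank-one `u`; the centre of `End(W₁)` is `K`).
* **`exists_eq_of_forall_commute_commutant`** — the DOUBLE COMMUTANT: every `Z ∈ End W` commuting with all of `C`
  is `c₀ P + c₁ (1 − P) + c₂ E + c₃ F`, i.e. lies in the subalgebra `≅ M₂(K)` spanned by `P, 1 − P, E, F` (Schur /
  double centraliser for the simple algebra `M₂(K) ⊗ 1 ⊆ End(std ⊗ W₁)`; proved by hand: the four corners `P Z P`,
  `E Z F`, `P Z F`, `E Z P` commute with every `P u P` because `P u P + α⁻¹ F (P u P) E ∈ C`).

## References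
* [FultonHarris1991] W. Fulton, J. Harris, *Representation Theory*, GTM 129 (1991), Lecture 11, §11.1 (isotypic
  `𝔰𝔩₂ℂ`-modules), §6.1.
* [Humphreys1972] J. E. Humphreys, *Introduction to Lie Algebras and Representation Theory*, GTM 9 (1972), §6.1
  (Schur's lemma), §7.2.
-/

namespace Literature.RepresentationTheory.GeneralLinear

universe u v

variable {K : Type u} [Field K] {W : Type v} [AddCommGroup W] [Module K W]

namespace SL2Triple

/-- **A corner element commuting with every corner element is a multiple of `P`**: if `P A = A = A P` and
`A (P u P) = (P u P) A` for all `u ∈ End W`, then `A = c P` (test against the rank-one operators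
`u = φ ⊗ x`; the centre of `End(W₁) = P (End W) P` is `K`).  [cite: Humphreys1972, §6.1] -/
theorem corner_eq_smul_of_forall_commute_corner {P A : Module.End K W} (hPA : P * A = A) (hAP : A * P = A)
    (hcomm : ∀ u : Module.End K W, A * (P * u * P) = P * u * P * A) : ∃ c : K, A = c • P := by
  by_cases hP0 : P = 0
  · exact ⟨0, by rw [← hPA, hP0, zero_mul, zero_smul]⟩
  obtain ⟨w₀, hw₀⟩ : ∃ w₀ : W, P w₀ ≠ 0 := by
    by_contra h
    push Not at h
    exact hP0 (LinearMap.ext fun w => by rw [h w, LinearMap.zero_apply])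
  obtain ⟨φ₀, hφ₀⟩ : ∃ φ₀ : Module.Dual K W, φ₀ (P w₀) ≠ 0 := by
    by_contra h
    push Not at h
    exact hw₀ ((Module.forall_dual_apply_eq_zero_iff K (P w₀)).1 h)
  refine ⟨(φ₀ (P w₀))⁻¹ * φ₀ (A w₀), LinearMap.ext fun x => ?_⟩
  have h := LinearMap.congr_fun (hcomm (φ₀.smulRight x)) w₀
  simp only [Module.End.mul_apply, LinearMap.smulRight_apply, map_smul] at h
  -- `h : φ₀ (P w₀) • A (P x) = φ₀ (P (A w₀)) • P x`
  have hAPx : A (P x) = A x := by rw [← Module.End.mul_apply, hAP]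
  have hPAw : P (A w₀) = A w₀ := by rw [← Module.End.mul_apply, hPA]
  rw [hAPx, hPAw] at h
  rw [LinearMap.smul_apply, mul_smul, ← h, smul_smul, inv_mul_cancel₀ hφ₀, one_smul]

/-- **The double commutant of an `𝔰𝔩₂`-triple in isotypic position is `K P ⊕ K (1 − P) ⊕ K E ⊕ K F`.**  With
`P² = P`, `P E = E`, `E P = 0`, `P F = 0`, `F P = F`, `E F = α P`, `F E = α (1 − P)`, `α ≠ 0` and `C` the commutant of
`{P, E, F}`: every `Z` commuting with all of `C` is `c₀ P + c₁ (1 − P) + c₂ E + c₃ F` (i.e. lies in the algebra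
`M₂(K) ⊗ 1` generated by the triple: the four corners `P Z P`, `E Z F`, `P Z F`, `E Z P` are `P`-corner elements
commuting with every `P u P` — test against `T = P u P + α⁻¹ F (P u P) E ∈ C` — hence scalars on `W₁`).
[cite: FultonHarris1991, Lecture 11 (§11.1)] [cite: Humphreys1972, §6.1] -/
theorem exists_eq_of_forall_commute_commutant {P E F : Module.End K W} {α : K} (hα : α ≠ 0)
    (hPP : P * P = P) (hPE : P * E = E) (hEP : E * P = 0) (hPF : P * F = 0) (hFP : F * P = F)
    (hEF : E * F = α • P) (hFE : F * E = α • (1 - P)) {C : Submodule K (Module.End K W)}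
    (hC : ∀ T, T ∈ C ↔ T * P = P * T ∧ T * E = E * T ∧ T * F = F * T)
    {Z : Module.End K W} (hZ : ∀ T ∈ C, Z * T = T * Z) :
    ∃ c : Fin 4 → K, Z = c 0 • P + c 1 • (1 - P) + c 2 • E + c 3 • F := by
  -- the test operators `T u = Q u + α⁻¹ F (Q u) E`, `Q u = P u P`
  have hPQ : ∀ u : Module.End K W, P * (P * u * P) = P * u * P := fun u => by
    rw [← mul_assoc, ← mul_assoc, hPP]
  have hQP : ∀ u : Module.End K W, P * u * P * P = P * u * P := fun u => by rw [mul_assoc, hPP]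
  have hZT : ∀ u : Module.End K W,
      Z * (P * u * P + α⁻¹ • (F * (P * u * P) * E)) = (P * u * P + α⁻¹ • (F * (P * u * P) * E)) * Z :=
    fun u => hZ _ (mem_commutant_of_corner hα hPE hEP hPF hFP hEF hC (hPQ u) (hQP u))
  -- products of the test operators with `P`, `E`, `F`
  have hTF : ∀ u : Module.End K W, (P * u * P + α⁻¹ • (F * (P * u * P) * E)) * F = F * (P * u * P) := by
    intro u
    rw [add_mul, mul_assoc (P * u) P F, hPF, mul_zero, zero_add, smul_mul_assoc, mul_assoc (F * (P * u * P)) E F,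
      hEF, mul_smul_comm, smul_smul, inv_mul_cancel₀ hα, one_smul, mul_assoc F (P * u * P) P, hQP]
  have hET : ∀ u : Module.End K W, E * (P * u * P + α⁻¹ • (F * (P * u * P) * E)) = P * u * P * E := by
    intro u
    rw [mul_add, ← mul_assoc E (P * u) P, ← mul_assoc E P u, hEP, zero_mul, zero_mul, zero_add, mul_smul_comm,
      ← mul_assoc E (F * (P * u * P)) E, ← mul_assoc E F (P * u * P), hEF, smul_mul_assoc, smul_mul_assoc,
      smul_smul, inv_mul_cancel₀ hα, one_smul, hPQ]
  have hPT : ∀ u : Module.End K W, P * (P * u * P + α⁻¹ • (F * (P * u * P) * E)) = P * u * P := by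
    intro u
    rw [mul_add, hPQ, mul_smul_comm, ← mul_assoc P (F * (P * u * P)) E, ← mul_assoc P F (P * u * P), hPF,
      zero_mul, zero_mul, smul_zero, add_zero]
  have hTP : ∀ u : Module.End K W, (P * u * P + α⁻¹ • (F * (P * u * P) * E)) * P = P * u * P := by
    intro u
    rw [add_mul, hQP, smul_mul_assoc, mul_assoc (F * (P * u * P)) E P, hEP, mul_zero, smul_zero, add_zero]
  -- the four corners commute with every `P u P`
  have h₁ : ∀ u : Module.End K W, P * Z * P * (P * u * P) = P * u * P * (P * Z * P) := by
    intro u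
    set Tu := P * u * P + α⁻¹ • (F * (P * u * P) * E) with hTu
    calc P * Z * P * (P * u * P) = P * Z * (P * (P * u * P)) := by simp only [mul_assoc]
      _ = P * Z * (Tu * P) := by rw [hPQ, hTP]
      _ = P * (Z * Tu) * P := by simp only [mul_assoc]
      _ = P * (Tu * Z) * P := by rw [hZT]
      _ = P * Tu * (Z * P) := by simp only [mul_assoc]
      _ = P * u * P * P * (Z * P) := by rw [hPT, hQP]
      _ = P * u * P * (P * Z * P) := by simp only [mul_assoc]
  have h₂ : ∀ u : Module.End K W, E * Z * F * (P * u * P) = P * u * P * (E * Z * F) := by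
    intro u
    set Tu := P * u * P + α⁻¹ • (F * (P * u * P) * E) with hTu
    calc E * Z * F * (P * u * P) = E * Z * (F * (P * u * P)) := by simp only [mul_assoc]
      _ = E * Z * (Tu * F) := by rw [hTF]
      _ = E * (Z * Tu) * F := by simp only [mul_assoc]
      _ = E * (Tu * Z) * F := by rw [hZT]
      _ = E * Tu * (Z * F) := by simp only [mul_assoc]
      _ = P * u * P * E * (Z * F) := by rw [hET]
      _ = P * u * P * (E * Z * F) := by simp only [mul_assoc]
  have h₃ : ∀ u : Module.End K W, P * Z * F * (P * u * P) = P * u * P * (P * Z * F) := by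
    intro u
    set Tu := P * u * P + α⁻¹ • (F * (P * u * P) * E) with hTu
    calc P * Z * F * (P * u * P) = P * Z * (F * (P * u * P)) := by simp only [mul_assoc]
      _ = P * Z * (Tu * F) := by rw [hTF]
      _ = P * (Z * Tu) * F := by simp only [mul_assoc]
      _ = P * (Tu * Z) * F := by rw [hZT]
      _ = P * Tu * (Z * F) := by simp only [mul_assoc]
      _ = P * u * P * P * (Z * F) := by rw [hPT, hQP]
      _ = P * u * P * (P * Z * F) := by simp only [mul_assoc]
  have h₄ : ∀ u : Module.End K W, E * Z * P * (P * u * P) = P * u * P * (E * Z * P) := by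
    intro u
    set Tu := P * u * P + α⁻¹ • (F * (P * u * P) * E) with hTu
    calc E * Z * P * (P * u * P) = E * Z * (P * (P * u * P)) := by simp only [mul_assoc]
      _ = E * Z * (Tu * P) := by rw [hPQ, hTP]
      _ = E * (Z * Tu) * P := by simp only [mul_assoc]
      _ = E * (Tu * Z) * P := by rw [hZT]
      _ = E * Tu * (Z * P) := by simp only [mul_assoc]
      _ = P * u * P * E * (Z * P) := by rw [hET]
      _ = P * u * P * (E * Z * P) := by simp only [mul_assoc]
  -- hence each corner is a multiple of `P`
  obtain ⟨c₁, hc₁⟩ := corner_eq_smul_of_forall_commute_corner (P := P) (A := P * Z * P)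
    (by rw [← mul_assoc, ← mul_assoc, hPP]) (by rw [mul_assoc, hPP]) h₁
  obtain ⟨c₂, hc₂⟩ := corner_eq_smul_of_forall_commute_corner (P := P) (A := E * Z * F)
    (by rw [← mul_assoc, ← mul_assoc, hPE]) (by rw [mul_assoc, hFP]) h₂
  obtain ⟨c₃, hc₃⟩ := corner_eq_smul_of_forall_commute_corner (P := P) (A := P * Z * F)
    (by rw [← mul_assoc, ← mul_assoc, hPP]) (by rw [mul_assoc, hFP]) h₃
  obtain ⟨c₄, hc₄⟩ := corner_eq_smul_of_forall_commute_corner (P := P) (A := E * Z * P)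
    (by rw [← mul_assoc, ← mul_assoc, hPE]) (by rw [mul_assoc, hPP]) h₄
  -- reconstruct `Z` from its four blocks, `1 - P = α⁻¹ F E`
  have h1P : (1 - P : Module.End K W) = α⁻¹ • (F * E) := by
    rw [hFE, smul_smul, inv_mul_cancel₀ hα, one_smul]
  have hdecomp : Z = P * Z * P + P * Z * (1 - P) + (1 - P) * Z * P + (1 - P) * Z * (1 - P) := by
    simp only [mul_sub, sub_mul, mul_one, one_mul, mul_assoc]
    abel
  have hb₂ : P * Z * (1 - P) = (α⁻¹ * c₃) • E := by
    rw [h1P, mul_smul_comm, ← mul_assoc (P * Z) F E, hc₃, smul_mul_assoc, hPE, smul_smul]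
  have hb₃ : (1 - P) * Z * P = (α⁻¹ * c₄) • F := by
    rw [h1P, smul_mul_assoc, smul_mul_assoc, mul_assoc F E Z, mul_assoc F (E * Z) P, hc₄, mul_smul_comm, hFP,
      smul_smul]
  have hb₄ : (1 - P) * Z * (1 - P) = (α⁻¹ * c₂) • (1 - P) := by
    conv_lhs => rw [h1P]
    rw [smul_mul_assoc, smul_mul_assoc, mul_smul_comm, mul_assoc F E Z, mul_assoc F (E * Z) (F * E),
      ← mul_assoc (E * Z) F E, hc₂, smul_mul_assoc, mul_smul_comm, ← mul_assoc, hFP, hFE, smul_smul, smul_smul,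
      smul_smul]
    congr 1
    field_simp
  refine ⟨![c₁, α⁻¹ * c₂, α⁻¹ * c₃, α⁻¹ * c₄], ?_⟩
  simp only [Matrix.cons_val_zero, Matrix.cons_val_one, Matrix.cons_val]
  rw [hdecomp, hc₁, hb₂, hb₃, hb₄]
  abel

end SL2Triple

end Literature.RepresentationTheory.GeneralLinear
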